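import Summits.HodgeConjecture.HodgeConjecture.Theorems.SecondaryPeriodsLevelOneConiveauThreefoldsCurveCorrespondencesRankTwo
import Summits.HodgeConjecture.HodgeConjecture.Theorems.SecondaryPeriodsLevelOneConiveauThreefoldsCurveCorrespondencesConverse
import Summits.HodgeConjecture.HodgeConjecture.Theorems.SecondaryPeriodsLevelOneConiveauThreefoldsDescent
import Literature.AlgebraicGeometry.HodgeTheory.SupportedClassesOfChowZeroSupportedAboveDim
import Literature.Barriers.HodgeConjecture.DecompositionOfTheDiagonalDegreeFourHolds

/-!
# `LevelOneConiveauThreefolds` (route `SecondaryPeriods`, crux stmt-HodgeConjecture-10376):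
# the KNOWN REGIME of GHC(3,1) is now a theorem of the tree — no Riemann hypothesis, all ranks

Line `registered` of the crux, lead c2, 2026-08-17. The crux (Grothendieck's amended GHC(3,1) for
smooth projective threefolds `Y/ℂ`) is open in general; its docstring records the known cases
"threefolds with `CH₀` supported on a curve (decomposition of the diagonal)". The previous lead's
file `…CurveCorrespondencesRankTwo` derived the known regime of the line CONDITIONALLY on the named
fact `BlochSrinivas1983_hodgeConjectureDegreeFour_of_chowZeroSupported` (rank two; all ranks only
granted Riemann's theorem), through the curve-correspondence mechanism on the fourfolds `Y × C`.
Two things changed in the tree the same morning: that named fact was DISCHARGED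
(`Barriers.HodgeConjecture.BlochSrinivas1983_hodgeConjectureDegreeFour_of_chowZeroSupported_holds`,
08:11Z), and — this lead's Literature theorem
`supportedClasses_three_one_eq_top_of_hasChowZeroSupportedInDimLE_two`
(`HodgeTheory/SupportedClassesOfChowZeroSupportedAboveDim`: Bloch–Srinivas decomposition of the
diagonal + Andreotti–Frankel on the resolution of the second support, hypothesis-free) — a smooth
projective threefold whose `CH₀` is supported on a SURFACE has `H³ = N¹H³` outright. Consequences
recorded here, all UNCONDITIONAL:

* `le_supportedClasses_of_hasChowZeroSupportedInDimLE_two` — for `Y` with `CH₀(Y)` supported in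
  dimension `≤ 2`, EVERY subspace of `H³(Y(ℂ); ℂ)` lies in `N¹H³(Y)`; in particular the body of the
  crux holds at `Y` in all ranks with no Riemann hypothesis (registered sub-goal
  `stub_knownRegime_chowZeroOnSurface`, pure-signature form). This covers and strengthens the
  docstring's "CH₀ supported on a curve".
* `curveCorrespondenceAlgebraic_of_hasChowZeroSupportedInDimLE_two` — STUB 2 of the line
  (`stub_curveCorrespondenceAlgebraic`: level-one curve correspondences `H¹(C) → H³(Y)` are
  algebraic codimension-2 classes on `Y ⊗ C`) holds at every such `Y`, for EVERY smooth projective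
  curve `C` — by the previous lead's converse `curveCorrespondenceAlgebraic_of_range_le_supportedClasses`
  (Deligne 8.2.8 + Hironaka + semisimplicity + Lefschetz (1,1), all proved).
* `curveCorrespondenceAlgebraic_of_hasChowZeroSupportedInDimLE_three` — STUB 2 at `(Y, C)` whenever
  `CH₀(Y ⊗ C)` is supported in dimension `≤ 3` (the previous lead's
  `curveCorrespondenceAlgebraic_of_blochSrinivas` with the Bloch–Srinivas fact discharged), and
  `span_le_supportedClasses_of_finrank_eq_two_of_hasChowZeroSupportedInDimLE_three` — the rank-two
  crux at `Y` when all `CH₀(Y ⊗ C)` are supported in dimension `≤ 3`.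
* `span_le_supportedClasses_of_hasDegree_of_hasChowZeroSupportedInDimLE_two` — by this lead's
  DESCENT theorem (`span_le_supportedClasses_of_hasDegree`): the body of the crux holds at every
  threefold `Y` receiving a morphism of non-zero degree from a threefold `Y'` with `CH₀(Y')`
  supported on a surface (e.g. `Y` dominated with a finite étale fibre by such a `Y'`).

What remains open is exactly the crux OUTSIDE this regime — threefolds with `h^{3,0} ≠ 0` or, more
generally, `CH₀` not supported on a surface (Calabi–Yau threefolds at the route's attractors).
-/

noncomputable section

-- `Summit.HodgeConjecture.HodgeConjecture.Theorems` is the mandated namespace (single-conjunct summit: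
-- Sub = Summit), which `linter.dupNamespace` flags on every declaration; the lakefile turns the
-- linter off tree-wide (weak option), restated here so stand-alone elaboration is warning-free too.
set_option linter.dupNamespace false

namespace Summit.HodgeConjecture.HodgeConjecture.Theorems

open CategoryTheory AlgebraicGeometry MonoidalCategory
open Literature.AlgebraicTopology.SingularHomology
open Literature.AlgebraicGeometry Literature.AlgebraicGeometry.Motives
open Literature.AlgebraicGeometry.HodgeTheory
open Literature.Barriers.HodgeConjecture

/-! ### GHC(3,1) at threefolds whose `CH₀` is supported on a surface — all ranks, no Riemann -/

/-- **Threefolds with `CH₀` supported on a surface: every subspace of `H³` is supported on a divisor.**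
For `Y` smooth projective of dimension `3` with `CH₀(Y)` supported on a closed algebraic subset of
dimension `≤ 2` (`HasChowZeroSupportedInDimLE Y 2`; e.g. `CH₀` supported on a curve or a point, `Y`
rationally connected, or `CH₀` moved onto a surface), `N¹H³(Y) = H³(Y(ℂ); ℂ)`
(`supportedClasses_three_one_eq_top_of_hasChowZeroSupportedInDimLE_two`: decomposition of the diagonal
+ Andreotti–Frankel), so `W ≤ N¹H³(Y)` for every `W`. [cite: BlochSrinivas1983, Thm. 1 (proof)]
[cite: VoisinHodgeII2003, Thm. 10.17, Cor. 10.21 and Thm. 1.22] [cite: GrothendieckTopology1969, §1 and p. 301] -/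
theorem le_supportedClasses_of_hasChowZeroSupportedInDimLE_two {Y : SchemeOver ℂ}
    (hY : IsSmoothProjective 3 Y) (hCH : HasChowZeroSupportedInDimLE Y 2)
    (W : Submodule ℂ (complexBetti Y 3)) : W ≤ supportedClasses Y 3 1 := by
  rw [supportedClasses_three_one_eq_top_of_hasChowZeroSupportedInDimLE_two hY hCH]
  exact le_top

/-- **Registered sub-goal `stub_knownRegime_chowZeroOnSurface`** of line `registered` of crux
stmt-HodgeConjecture-10376 (lead c2): the body of `LevelOneConiveauThreefolds` at every smooth
projective threefold whose `CH₀` is supported in dimension `≤ 2` — UNCONDITIONALLY, in all ranks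
(the crux's binders verbatim, preceded by the regime hypothesis; the rationality / sub-Hodge /
level-one hypotheses are not even needed). [cite: BlochSrinivas1983, Thm. 1 (proof)]
[cite: VoisinHodgeII2003, Thm. 10.17, Cor. 10.21 and Thm. 1.22] -/
theorem stub_knownRegime_chowZeroOnSurface : ∀ ⦃Y : Motives.SchemeOver ℂ⦄ (hY : Motives.IsSmoothProjective 3 Y), Literature.Barriers.HodgeConjecture.HasChowZeroSupportedInDimLE Y 2 → ∀ (A : HodgeModel 3 Y) (s : Finset (complexBetti Y 3)), (∀ c ∈ s, IsRationalClass c) → (Submodule.span ℂ (↑s : Set (complexBetti Y 3))).map (A.pullback 3).hom = (⨆ (p : ℕ) (q : ℕ) (_ : p + q = 3), (Submodule.span ℂ (↑s : Set (complexBetti Y 3))).map (A.pullback 3).hom ⊓ A.hodgePQ 3 p q) → (Submodule.span ℂ (↑s : Set (complexBetti Y 3))).map (A.pullback 3).hom ≤ (⨆ (p : ℕ) (q : ℕ) (_ : p + q = 3) (_ : 1 ≤ p) (_ : 1 ≤ q), A.hodgePQ 3 p q) → Submodule.span ℂ (↑s : Set (complexBetti Y 3)) ≤ supportedClasses Y 3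 1 :=
  fun _ hY hCH _ _ _ _ _ ↦ le_supportedClasses_of_hasChowZeroSupportedInDimLE_two hY hCH _

/-! ### STUB 2 in the known regime — unconditional -/

/-- **STUB 2 at every threefold with `CH₀` on a surface, for every curve.** For `Y` smooth projective
of dimension `3` with `HasChowZeroSupportedInDimLE Y 2`, `C` any smooth projective curve, Hodge
models `A`, `B`, and any rational type-`(1,1)` map `φ : H¹(C(ℂ)) → H³(Y(ℂ))`: `φ = γ_*` for an
ALGEBRAIC codimension-2 class `γ` on `Y ⊗ C` (every orientation family). Since `range φ ≤ H³ = N¹H³(Y)`,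
this is the previous lead's converse `curveCorrespondenceAlgebraic_of_range_le_supportedClasses`
(lift through the Gysin maps of desingularised supporting surfaces, then Lefschetz (1,1) on `C × S̃`).
[cite: GrothendieckTopology1969, p. 301] [cite: KerrPearlstein2016, Ch. 11 (Abdulali) Prop. 3.2 p. 291]
[cite: BlochSrinivas1983, Thm. 1 (proof)] -/
theorem curveCorrespondenceAlgebraic_of_hasChowZeroSupportedInDimLE_two {Y C : SchemeOver ℂ}
    (hY : IsSmoothProjective 3 Y) (hC : IsSmoothProjective 1 C) (hCH : HasChowZeroSupportedInDimLE Y 2)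
    (A : HodgeModel 3 Y) (B : HodgeModel 1 C) (φ : complexBetti C 1 →ₗ[ℂ] complexBetti Y 3)
    (hφ : ∀ c, IsRationalClass c → IsRationalClass (φ c))
    (hφH : ∀ (p q : ℕ), p + q = 1 → ∀ c, B.pullback 1 c ∈ B.hodgePQ 1 p q →
      A.pullback 3 (φ c) ∈ A.hodgePQ 3 (p + 1) (q + 1)) (μ : OrientationFamily) :
    ∃ γ ∈ algebraicClasses (Y ⊗ C) 2,
      corrAction μ hY hC (show 1 + 2 * 2 = 3 + 2 * 1 from rfl) γ = φ :=
  curveCorrespondenceAlgebraic_of_range_le_supportedClasses hY hC A B φ hφ hφH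
    (le_supportedClasses_of_hasChowZeroSupportedInDimLE_two hY hCH _) μ

/-- **STUB 2 at `(Y, C)` whenever `CH₀(Y ⊗ C)` is supported in dimension `≤ 3`** — the previous
lead's `curveCorrespondenceAlgebraic_of_blochSrinivas` with the Bloch–Srinivas / Voisin II Prop. 10.26
fact now DISCHARGED in the tree (`BlochSrinivas1983_hodgeConjectureDegreeFour_of_chowZeroSupported_holds`):
rational `(2,2)`-classes on such a fourfold are algebraic, in particular the class inducing `φ`
(Voisin I Lemma 11.41). [cite: VoisinHodgeII2003, Prop. 10.26] [cite: BlochSrinivas1983, Thm. 1 (3)]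
[cite: VoisinHodgeI2002, §11.3.3 Lemma 11.41] -/
theorem curveCorrespondenceAlgebraic_of_hasChowZeroSupportedInDimLE_three {Y C : SchemeOver ℂ}
    (hY : IsSmoothProjective 3 Y) (hC : IsSmoothProjective 1 C)
    (hCH : HasChowZeroSupportedInDimLE (Y ⊗ C) 3)
    (A : HodgeModel 3 Y) (B : HodgeModel 1 C) (φ : complexBetti C 1 →ₗ[ℂ] complexBetti Y 3)
    (hφ : ∀ c, IsRationalClass c → IsRationalClass (φ c))
    (hφH : ∀ (p q : ℕ), p + q = 1 → ∀ c, B.pullback 1 c ∈ B.hodgePQ 1 p q →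
      A.pullback 3 (φ c) ∈ A.hodgePQ 3 (p + 1) (q + 1)) (μ : OrientationFamily) :
    ∃ γ ∈ algebraicClasses (Y ⊗ C) 2,
      corrAction μ hY hC (show 1 + 2 * 2 = 3 + 2 * 1 from rfl) γ = φ :=
  curveCorrespondenceAlgebraic_of_blochSrinivas
    BlochSrinivas1983_hodgeConjectureDegreeFour_of_chowZeroSupported_holds hY hC hCH A B φ hφ hφH μ

/-- **Rank-two GHC(3,1) at `Y` when all `CH₀(Y ⊗ C)` are supported in dimension `≤ 3`** — the
previous lead's `span_le_supportedClasses_of_finrank_eq_two_of_blochSrinivas`, now unconditional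
(Bloch–Srinivas discharged; rank-two Riemann via elliptic curves). [cite: VoisinHodgeII2003, Prop. 10.26]
[cite: BlochSrinivas1983, Thm. 1 (3)] [cite: GrothendieckTopology1969, p. 301] -/
theorem span_le_supportedClasses_of_finrank_eq_two_of_hasChowZeroSupportedInDimLE_three
    {Y : SchemeOver ℂ} (hY : IsSmoothProjective 3 Y)
    (hCH : ∀ ⦃C : SchemeOver ℂ⦄, IsSmoothProjective 1 C → HasChowZeroSupportedInDimLE (Y ⊗ C) 3)
    (A : HodgeModel 3 Y) (s : Finset (complexBetti Y 3)) (hs : ∀ c ∈ s, IsRationalClass c)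
    (hs2 : Module.finrank ℂ (Submodule.span ℂ (↑s : Set (complexBetti Y 3))) = 2)
    (hsub : (Submodule.span ℂ (↑s : Set (complexBetti Y 3))).map (A.pullback 3).hom =
      ⨆ (p : ℕ) (q : ℕ) (_ : p + q = 3),
        (Submodule.span ℂ (↑s : Set (complexBetti Y 3))).map (A.pullback 3).hom ⊓ A.hodgePQ 3 p q)
    (hlev : (Submodule.span ℂ (↑s : Set (complexBetti Y 3))).map (A.pullback 3).hom ≤
      ⨆ (p : ℕ) (q : ℕ) (_ : p + q = 3) (_ : 1 ≤ p) (_ : 1 ≤ q), A.hodgePQ 3 p q) :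
    Submodule.span ℂ (↑s : Set (complexBetti Y 3)) ≤ supportedClasses Y 3 1 :=
  span_le_supportedClasses_of_finrank_eq_two_of_blochSrinivas
    BlochSrinivas1983_hodgeConjectureDegreeFour_of_chowZeroSupported_holds hY hCH A s hs hs2 hsub hlev

/-! ### The known regime is closed under morphisms of non-zero degree (descent) -/

/-- **GHC(3,1) at every threefold dominated, with non-zero degree, by a threefold whose `CH₀` is
supported on a surface.** If `g : Y' ⟶ Y` has degree `d ≠ 0` (`HasDegree μ ν g(ℂ) d`) and
`CH₀(Y')` is supported in dimension `≤ 2`, then every rationally spanned level-one sub-Hodge structure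
of `H³(Y(ℂ); ℂ)` lies in `N¹H³(Y)` (this lead's descent `span_le_supportedClasses_of_hasDegree` fed
with `le_supportedClasses_of_hasChowZeroSupportedInDimLE_two` at `Y'`).
[cite: GrothendieckTopology1969, §1 and p. 301] [cite: FultonYoungTableaux1997, Appendix B §B.1 (5)–(7)]
[cite: BlochSrinivas1983, Thm. 1 (proof)] -/
theorem span_le_supportedClasses_of_hasDegree_of_hasChowZeroSupportedInDimLE_two {Y' Y : SchemeOver ℂ}
    (hY' : IsSmoothProjective 3 Y') (hY : IsSmoothProjective 3 Y) (g : Y' ⟶ Y)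
    (μ : HomologicalOrientation ℂ (ComplexPoints Y') (2 * 3))
    (ν : HomologicalOrientation ℂ (ComplexPoints Y) (2 * 3)) {d : ℤ} (hd : d ≠ 0)
    (hg : HasDegree μ ν (AlgPoints.mapContinuous (L := ℂ) g) d)
    (hCH : HasChowZeroSupportedInDimLE Y' 2)
    (A : HodgeModel 3 Y) (s : Finset (complexBetti Y 3)) (hs : ∀ c ∈ s, IsRationalClass c)
    (hsub : (Submodule.span ℂ (↑s : Set (complexBetti Y 3))).map (A.pullback 3).hom =
      ⨆ (p : ℕ) (q : ℕ) (_ : p + q = 3),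
        (Submodule.span ℂ (↑s : Set (complexBetti Y 3))).map (A.pullback 3).hom ⊓ A.hodgePQ 3 p q)
    (hlev : (Submodule.span ℂ (↑s : Set (complexBetti Y 3))).map (A.pullback 3).hom ≤
      ⨆ (p : ℕ) (q : ℕ) (_ : p + q = 3) (_ : 1 ≤ p) (_ : 1 ≤ q), A.hodgePQ 3 p q) :
    Submodule.span ℂ (↑s : Set (complexBetti Y 3)) ≤ supportedClasses Y 3 1 :=
  span_le_supportedClasses_of_hasDegree hY' hY g μ ν hd hg
    (fun _ _ _ _ _ ↦ le_supportedClasses_of_hasChowZeroSupportedInDimLE_two hY' hCH _) A s hs hsub hlev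

end Summit.HodgeConjecture.HodgeConjecture.Theorems

end
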